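import Literature.Computability.FineGrained.Sweep1EqualityRep
import Mathlib.Algebra.BigOperators.Fin
import Mathlib.Algebra.Order.BigOperators.Ring.Finset
import HarnessLib

/-!
# Fine-grained complexity, sweep 1: tensoring equality representations and counting keys

The counting identity behind R. Williams' OV algorithm (*The Orthogonal Vectors Conjecture and
Non-Uniform Circuit Lower Bounds*, FOCS 2024 / ECCC TR24-142, Thm. 8 "Uniformization" and the
deterministic Thm. 10), in the exact arithmetic form computed by the word-RAM program of
`…FineGrained.Sweep1OVProgram`:

Fix a positive representation `R : PosRep k (2^ρ) lam` of `DISJ_k` (`…Sweep1EqualityRep`), rows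
`X Y : ℕ → ℕ → Bool` (row index, bit index; `n` rows each, read in `B` blocks of `k` bits,
`blk`), and let `Q < (2^ρ)^B` range over the `B`-tuples of term indices, with digits
`digit ρ Q m = ⌊Q / 2^{ρ m}⌋ mod 2^ρ`.

* `coef R B Q = Π_{m<B} α_{Q_m}`; `keyU R B X Q i = Σ_{m<B} u_{Q_m}[X_i|ₘ] · 2^{lam·m}` and
  `keyV` likewise (the defining vectors of the Kronecker product of equality matrices are the
  concatenations — here base-`2^lam` numbers — of the defining vectors, Thm. 8, p. 7);
  `tcount n B X Y Q = Σ_{j<n} #{i < n : keyU Q i = keyV Q j}` (the double sum `T_k` of Thm. 10,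
  evaluated by bucketing equal keys); `S = Σ_Q coef Q · tcount Q`.
* `S_eq` (**the tensor identity**, Thm. 8 ∘ Thm. 10): `S = Σ_{i,j<n} Π_{m<B} P(X_i|ₘ, Y_j|ₘ)` where
  `P = Σ_ℓ α_ℓ E_ℓ ≥ 0` is the representation; hence `0 ≤ S ≤ n² (Σ|α|)^B` (`S_nonneg`, `S_le`)
  and `S ≠ 0 ↔` some pair of rows is blockwise disjoint (`S_ne_zero_iff`), i.e., for the rows
  `rowA I`, `rowB I` of an OV instance, iff `I.HasOrthogonalPair` (`S_ne_zero_iff_hasOrthogonalPair`).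
* The machine forms of the same quantities, indexed by bit positions `t < B k` as the program's
  loops compute them: `Wt` (the weight of bit `t`), `cuT`, `cvT`, `alT`, with `coef_eq_prod_alT`,
  `cuQ_eq_sum`, `cvQ_eq_sum`, `keyU_eq_sum_Wt`, `keyV_eq_sum_Wt`, and the digit bounds
  `keyU_lt`, `keyV_lt` (`< 2^{lam B}`).

## References

* R. Williams, *The Orthogonal Vectors Conjecture and Non-Uniform Circuit Lower Bounds*,
  FOCS 2024; ECCC TR24-142, Thm. 8 (pp. 6–8), Thm. 10 (p. 10), proof of Thm. 3 (p. 11).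
-/

namespace Literature.Computability.FineGrained

open Finset Cryptography

namespace EThr2

/-! ### Sums over `range (B * k)` in blocks -/

/-- A sum over `t < B k` in `B` blocks of `k` consecutive indices. [folklore] -/
theorem sum_range_mul_eq {M : Type*} [AddCommMonoid M] (f : ℕ → M) (B k : ℕ) :
    ∑ t ∈ range (B * k), f t = ∑ m ∈ range B, ∑ s ∈ range k, f (m * k + s) := by
  induction B with
  | zero => simp
  | succ B ih => rw [Nat.succ_mul, Finset.sum_range_add, ih, Finset.sum_range_succ]

/-- A product over `t < B k` in `B` blocks of `k` consecutive indices. [folklore] -/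
theorem prod_range_mul_eq {M : Type*} [CommMonoid M] (f : ℕ → M) (B k : ℕ) :
    ∏ t ∈ range (B * k), f t = ∏ m ∈ range B, ∏ s ∈ range k, f (m * k + s) := by
  induction B with
  | zero => simp
  | succ B ih => rw [Nat.succ_mul, Finset.prod_range_add, ih, Finset.prod_range_succ]

/-- Base-`2^lam` numbers with `B` digits are below `2^{lam B}`. [folklore] -/
theorem sum_digits_lt {lam B : ℕ} (u : ℕ → ℤ) (hu : ∀ m, m < B → 0 ≤ u m ∧ u m < 2 ^ lam) :
    0 ≤ ∑ m ∈ range B, u m * 2 ^ (lam * m) ∧ ∑ m ∈ range B, u m * 2 ^ (lam * m) < 2 ^ (lam * B) := by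
  induction B with
  | zero => simp
  | succ B ih =>
    obtain ⟨ih1, ih2⟩ := ih fun m hm => hu m (by omega)
    obtain ⟨h1, h2⟩ := hu B (by omega)
    rw [Finset.sum_range_succ]
    have hpos : (0 : ℤ) < 2 ^ (lam * B) := by positivity
    have h3 : u B * 2 ^ (lam * B) ≤ (2 ^ lam - 1) * 2 ^ (lam * B) :=
      mul_le_mul_of_nonneg_right (by omega) hpos.le
    have h4 : ((2 : ℤ) ^ lam - 1) * 2 ^ (lam * B) = 2 ^ (lam * (B + 1)) - 2 ^ (lam * B) := by
      rw [Nat.mul_succ, pow_add]; ring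
    constructor
    · nlinarith
    · nlinarith

/-- **Uniqueness of base-`2^lam` digits.** [folklore] -/
theorem digits_inj {lam B : ℕ} (u v : ℕ → ℤ) (hu : ∀ m, m < B → 0 ≤ u m ∧ u m < 2 ^ lam)
    (hv : ∀ m, m < B → 0 ≤ v m ∧ v m < 2 ^ lam)
    (h : ∑ m ∈ range B, u m * 2 ^ (lam * m) = ∑ m ∈ range B, v m * 2 ^ (lam * m)) :
    ∀ m, m < B → u m = v m := by
  induction B with
  | zero => intro m hm; omega
  | succ B ih =>
    rw [Finset.sum_range_succ, Finset.sum_range_succ] at h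
    obtain ⟨hu1, hu2⟩ := sum_digits_lt u fun m hm => hu m (Nat.lt_succ_of_lt hm)
    obtain ⟨hv1, hv2⟩ := sum_digits_lt v fun m hm => hv m (Nat.lt_succ_of_lt hm)
    have hpos : (0 : ℤ) < 2 ^ (lam * B) := by positivity
    -- the top digits agree
    have htop : u B = v B := by
      by_contra hne
      rcases lt_or_gt_of_ne hne with hlt | hgt
      · have : (u B + 1) * 2 ^ (lam * B) ≤ v B * 2 ^ (lam * B) :=
          mul_le_mul_of_nonneg_right (by omega) hpos.le
        nlinarith
      · have : (v B + 1) * 2 ^ (lam * B) ≤ u B * 2 ^ (lam * B) :=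
          mul_le_mul_of_nonneg_right (by omega) hpos.le
        nlinarith
    intro m hm
    rcases Nat.lt_succ_iff_lt_or_eq.1 hm with hm' | rfl
    · rw [htop] at h
      exact ih (fun m hm => hu m (Nat.lt_succ_of_lt hm)) (fun m hm => hv m (Nat.lt_succ_of_lt hm))
        (by linarith) m hm'
    · exact htop

/-! ### Digits, blocks, keys, coefficients -/

variable {k ρ lam : ℕ}

/-- The `m`-th digit of `Q` in base `2^ρ`: `⌊Q / 2^{ρ m}⌋ mod 2^ρ` (the index of the `m`-th factor
of the `Q`-th term of the Kronecker power, Williams, ECCC TR24-142, proof of Thm. 8). [cite: WilliamsFOCS2024, Thm. 8 (proof)] -/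
def digit (ρ Q m : ℕ) : Fin (2 ^ ρ) := ⟨Q / 2 ^ (ρ * m) % 2 ^ ρ, Nat.mod_lt _ (by positivity)⟩

/-- The value of a digit. [folklore] -/
@[simp] theorem digit_val (ρ Q m : ℕ) : (digit ρ Q m : ℕ) = Q / 2 ^ (ρ * m) % 2 ^ ρ := rfl

/-- The `m`-th block of `k` bits of row `i` of `X`: `s ↦ X i (m k + s)`. [folklore] -/
def blk (k : ℕ) (X : ℕ → ℕ → Bool) (i m : ℕ) : Fin k → Bool := fun s => X i (m * k + s)

variable (R : PosRep k (2 ^ ρ) lam)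

namespace PosRep

/-- The representation polynomial `P(x, y) = Σ_ℓ α_ℓ E_ℓ(x, y)`. [cite: WilliamsFOCS2024, §1 (weak equality rank)] -/
def P (x y : Fin k → Bool) : ℤ := ∑ ℓ, if (R.test ℓ).Holds x y then R.α ℓ else 0

/-- The coefficient `Π_{m<B} α_{Q_m}` of the `Q`-th term of the `B`-th Kronecker power
(Williams, ECCC TR24-142, Thm. 8: "the coefficient of the `q`-th matrix is `Π_m α_{q_m}`"). [cite: WilliamsFOCS2024, Thm. 8 (proof)] -/
def coef (B Q : ℕ) : ℤ := ∏ m ∈ range B, R.α (digit ρ Q m)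

/-- The row key of row `i` for the `Q`-th term: `Σ_{m<B} u_{Q_m}[X_i|ₘ] 2^{lam m}` — the
concatenation `U^{(q)}` of the defining vectors of the factors, written in base `2^lam`
(Williams, ECCC TR24-142, Thm. 8, p. 7). [cite: WilliamsFOCS2024, Thm. 8 (proof)] -/
def keyU (B : ℕ) (X : ℕ → ℕ → Bool) (Q i : ℕ) : ℤ :=
  ∑ m ∈ range B, (R.test (digit ρ Q m)).u (blk k X i m) * 2 ^ (lam * m)

/-- The column key of row `j` of `Y` for the `Q`-th term (`V^{(q)}` of loc. cit.). [cite: WilliamsFOCS2024, Thm. 8 (proof)] -/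
def keyV (B : ℕ) (Y : ℕ → ℕ → Bool) (Q j : ℕ) : ℤ :=
  ∑ m ∈ range B, (R.test (digit ρ Q m)).v (blk k Y j m) * 2 ^ (lam * m)

/-- The number of pairs with equal keys, bucketed by the column side:
`Σ_{j<n} #{i < n : keyU Q i = keyV Q j}` (the double sum `T` of Williams, ECCC TR24-142, proof of
Thm. 10, evaluated by counting equal values). [cite: WilliamsFOCS2024, Thm. 10 (proof)] -/
def tcount (n B : ℕ) (X Y : ℕ → ℕ → Bool) (Q : ℕ) : ℕ :=
  ∑ j ∈ range n, ((range n).filter fun i => R.keyU B X Q i = R.keyV B Y Q j).card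

/-- The weighted count `S = Σ_{Q < (2^ρ)^B} coef Q · tcount Q` (the quantity `S'` of Williams,
ECCC TR24-142, proof of Thm. 10, for the tensored representation of Thm. 8). [cite: WilliamsFOCS2024, Thm. 10 (proof)] -/
def S (n B : ℕ) (X Y : ℕ → ℕ → Bool) : ℤ :=
  ∑ Q ∈ range ((2 ^ ρ) ^ B), R.coef B Q * (R.tcount n B X Y Q : ℤ)

/-! ### The tensor identity -/

/-- Digits enumerate tuples: summing a function of the digit tuple over `Q < (2^ρ)^B` is summing
over all tuples `Fin B → Fin (2^ρ)`. [folklore] -/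
theorem sum_range_pow_eq_sum_fun {M : Type*} [AddCommMonoid M] (B : ℕ)
    (F : (Fin B → Fin (2 ^ ρ)) → M) :
    ∑ Q ∈ range ((2 ^ ρ) ^ B), F (fun m => digit ρ Q m) = ∑ q : Fin B → Fin (2 ^ ρ), F q := by
  rw [← Fin.sum_univ_eq_sum_range (fun Q => F (fun m => digit ρ Q m)) ((2 ^ ρ) ^ B),
    ← Equiv.sum_comp finFunctionFinEquiv]
  refine Finset.sum_congr rfl (fun q _ => congrArg F (funext fun m => ?_))
  have := congrFun (finFunctionFinEquiv.symm_apply_apply q) m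
  rw [← this]
  apply Fin.ext
  rw [finFunctionFinEquiv_symm_apply_val, digit_val, pow_mul]

/-- Keys agree iff all digits agree. [cite: WilliamsFOCS2024, Thm. 8 (proof)] -/
theorem keyU_eq_keyV_iff (B : ℕ) (X Y : ℕ → ℕ → Bool) (Q i j : ℕ) :
    R.keyU B X Q i = R.keyV B Y Q j ↔
      ∀ m, m < B → (R.test (digit ρ Q m)).Holds (blk k X i m) (blk k Y j m) := by
  constructor
  · intro h m hm
    exact digits_inj (fun m => (R.test (digit ρ Q m)).u (blk k X i m))
      (fun m => (R.test (digit ρ Q m)).v (blk k Y j m)) (fun m _ => R.u_range _ _)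
      (fun m _ => R.v_range _ _) h m hm
  · intro h
    exact Finset.sum_congr rfl fun m hm => by rw [(h m (Finset.mem_range.1 hm) : _ = _)]

/-- One pair of rows: `Σ_Q coef Q · [keyU Q i = keyV Q j] = Π_{m<B} P(X_i|ₘ, Y_j|ₘ)`
(distributivity over the Kronecker power, Williams, ECCC TR24-142, Thm. 8). [cite: WilliamsFOCS2024, Thm. 8 (proof)] -/
theorem sum_coef_ite_eq_prod (B : ℕ) (X Y : ℕ → ℕ → Bool) (i j : ℕ) :
    ∑ Q ∈ range ((2 ^ ρ) ^ B), (if R.keyU B X Q i = R.keyV B Y Q j then R.coef B Q else 0) =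
      ∏ m ∈ range B, R.P (blk k X i m) (blk k Y j m) := by
  classical
  -- the summand as a function of the digit tuple
  let g : Fin (2 ^ ρ) → ℕ → ℤ := fun ℓ m =>
    if (R.test ℓ).Holds (blk k X i m) (blk k Y j m) then R.α ℓ else 0
  obtain ⟨F, hF⟩ : ∃ F : (Fin B → Fin (2 ^ ρ)) → ℤ, ∀ q, F q = ∏ m : Fin B, g (q m) m :=
    ⟨_, fun q => rfl⟩
  have hsummand : ∀ Q, (if R.keyU B X Q i = R.keyV B Y Q j then R.coef B Q else 0) =
      F (fun m => digit ρ Q m) := by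
    intro Q
    rw [hF, Fin.prod_univ_eq_prod_range (fun m => g (digit ρ Q m) m) B]
    simp only [g]
    rw [Finset.prod_ite_zero, coef]
    refine if_congr ?_ rfl rfl
    rw [R.keyU_eq_keyV_iff B X Y Q i j]
    simp only [Finset.mem_range]
  rw [Finset.sum_congr rfl (fun Q _ => hsummand Q), sum_range_pow_eq_sum_fun B F]
  simp_rw [hF]
  rw [← Fin.prod_univ_eq_prod_range (fun m => R.P (blk k X i m) (blk k Y j m)) B]
  show ∑ q : Fin B → Fin (2 ^ ρ), ∏ m : Fin B, g (q m) m = ∏ m : Fin B, ∑ ℓ, g ℓ (m : ℕ)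
  rw [Finset.prod_univ_sum, Fintype.piFinset_univ]

/-- `tcount` as a double sum of indicators. [folklore] -/
theorem tcount_eq (n B : ℕ) (X Y : ℕ → ℕ → Bool) (Q : ℕ) :
    (R.tcount n B X Y Q : ℤ) =
      ∑ i ∈ range n, ∑ j ∈ range n, (if R.keyU B X Q i = R.keyV B Y Q j then 1 else 0 : ℤ) := by
  rw [tcount, Finset.sum_comm]
  push_cast
  refine Finset.sum_congr rfl (fun j _ => ?_)
  rw [Finset.card_filter]
  push_cast
  rfl

/-- **The tensor identity** (Williams, ECCC TR24-142, Thm. 8 with the counting of Thm. 10):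
`S = Σ_{Q} coef Q · tcount Q = Σ_{i<n} Σ_{j<n} Π_{m<B} P(X_i|ₘ, Y_j|ₘ)`. [cite: WilliamsFOCS2024, Thm. 8, Thm. 10] -/
theorem S_eq (n B : ℕ) (X Y : ℕ → ℕ → Bool) :
    R.S n B X Y = ∑ i ∈ range n, ∑ j ∈ range n, ∏ m ∈ range B, R.P (blk k X i m) (blk k Y j m) := by
  unfold S
  simp_rw [tcount_eq, Finset.mul_sum]
  rw [Finset.sum_comm]
  refine Finset.sum_congr rfl (fun i _ => ?_)
  rw [Finset.sum_comm]
  refine Finset.sum_congr rfl (fun j _ => ?_)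
  rw [← R.sum_coef_ite_eq_prod B X Y i j]
  refine Finset.sum_congr rfl (fun Q _ => ?_)
  split_ifs <;> simp

/-! ### Sign and size of `S` -/

/-- `P ≤ Σ_ℓ |α_ℓ|`. [folklore] -/
theorem P_le (x y : Fin k → Bool) : R.P x y ≤ ∑ ℓ, |R.α ℓ| :=
  Finset.sum_le_sum fun ℓ _ => by split_ifs <;> simp [le_abs_self]

/-- `0 ≤ S`. [cite: WilliamsFOCS2024, Thm. 10 (proof: `S' ≥ 0`)] -/
theorem S_nonneg (n B : ℕ) (X Y : ℕ → ℕ → Bool) : 0 ≤ R.S n B X Y := by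
  rw [S_eq]
  exact Finset.sum_nonneg fun i _ => Finset.sum_nonneg fun j _ =>
    Finset.prod_nonneg fun m _ => R.nonneg _ _

/-- `S ≤ n² (Σ_ℓ |α_ℓ|)^B`. [folklore] -/
theorem S_le (n B : ℕ) (X Y : ℕ → ℕ → Bool) : R.S n B X Y ≤ n * n * (∑ ℓ, |R.α ℓ|) ^ B := by
  rw [S_eq]
  have hterm : ∀ i j, ∏ m ∈ range B, R.P (blk k X i m) (blk k Y j m) ≤ (∑ ℓ, |R.α ℓ|) ^ B := by
    intro i j
    calc ∏ m ∈ range B, R.P (blk k X i m) (blk k Y j m) ≤ ∏ _m ∈ range B, ∑ ℓ, |R.α ℓ| :=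
          Finset.prod_le_prod (fun m _ => R.nonneg _ _) (fun m _ => R.P_le _ _)
      _ = (∑ ℓ, |R.α ℓ|) ^ B := by rw [Finset.prod_const, Finset.card_range]
  calc ∑ i ∈ range n, ∑ j ∈ range n, ∏ m ∈ range B, R.P (blk k X i m) (blk k Y j m)
      ≤ ∑ _i ∈ range n, ∑ _j ∈ range n, (∑ ℓ, |R.α ℓ|) ^ B :=
        Finset.sum_le_sum fun i _ => Finset.sum_le_sum fun j _ => hterm i j
    _ = n * n * (∑ ℓ, |R.α ℓ|) ^ B := by
        simp only [Finset.sum_const, Finset.card_range, nsmul_eq_mul]; ring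

/-- **`S` detects a blockwise disjoint pair**: `S ≠ 0` iff some row of `X` and some row of `Y`
(among the first `n`) are disjoint on each of the `B` blocks (Williams, ECCC TR24-142, proof of
Thm. 10: "if there is no satisfying pair then `S' = 0`, and if there is then `S' > 0`"). [cite: WilliamsFOCS2024, Thm. 10 (proof)] -/
theorem S_ne_zero_iff (n B : ℕ) (X Y : ℕ → ℕ → Bool) :
    R.S n B X Y ≠ 0 ↔ ∃ i, i < n ∧ ∃ j, j < n ∧ ∀ m, m < B → Disj (blk k X i m) (blk k Y j m) := by
  have hP0 : ∀ i j m, 0 ≤ R.P (blk k X i m) (blk k Y j m) := fun i j m => R.nonneg _ _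
  have hprod : ∀ i j, 0 ≤ ∏ m ∈ range B, R.P (blk k X i m) (blk k Y j m) :=
    fun i j => Finset.prod_nonneg fun m _ => hP0 i j m
  rw [ne_comm, ← (R.S_nonneg n B X Y).lt_iff_ne,
    S_eq, Finset.sum_pos_iff_of_nonneg (fun i _ => Finset.sum_nonneg fun j _ => hprod i j)]
  simp only [Finset.mem_range]
  refine exists_congr fun i => and_congr_right fun _ => ?_
  rw [Finset.sum_pos_iff_of_nonneg (fun j _ => hprod i j)]
  simp only [Finset.mem_range]
  refine exists_congr fun j => and_congr_right fun _ => ?_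
  constructor
  · intro h m hm
    have hm' : 0 < R.P (blk k X i m) (blk k Y j m) := by
      by_contra hle
      have h0 : R.P (blk k X i m) (blk k Y j m) = 0 := le_antisymm (not_lt.1 hle) (hP0 i j m)
      exact h.ne' (Finset.prod_eq_zero (Finset.mem_range.2 hm) h0)
    exact (R.pos_iff _ _).1 hm'
  · intro h
    exact Finset.prod_pos fun m hm => (R.pos_iff _ _).2 (h m (Finset.mem_range.1 hm))

end PosRep

/-! ### Rows of an OV instance -/

/-- Row `i` of the first list of an OV instance as a total bit function (`false` out of range). [folklore] -/
def rowA (I : OVInstance) (i t : ℕ) : Bool :=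
  if h : i < I.n ∧ t < I.d then I.A ⟨i, h.1⟩ ⟨t, h.2⟩ else false

/-- Row `j` of the second list of an OV instance as a total bit function. [folklore] -/
def rowB (I : OVInstance) (j t : ℕ) : Bool :=
  if h : j < I.n ∧ t < I.d then I.B ⟨j, h.1⟩ ⟨t, h.2⟩ else false

/-- **Blockwise disjointness is orthogonality** when the `B` blocks of `k` bits cover the `d`
coordinates (`DISJ_d = DISJ_k^{⊗ d/k}`, Williams, ECCC TR24-142, proof of Thm. 8; the padding
bits are `0`). [cite: WilliamsFOCS2024, Thm. 8 (proof)] -/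
theorem hasOrthogonalPair_iff_blocks (I : OVInstance) {B : ℕ} (hk : 0 < k) (hB : I.d ≤ B * k) :
    I.HasOrthogonalPair ↔ ∃ i, i < I.n ∧ ∃ j, j < I.n ∧
      ∀ m, m < B → Disj (blk k (rowA I) i m) (blk k (rowB I) j m) := by
  constructor
  · rintro ⟨i, j, h⟩
    refine ⟨i, i.2, j, j.2, fun m _ s ⟨hx, hy⟩ => ?_⟩
    simp only [blk, rowA, rowB] at hx hy
    by_cases ht : m * k + s < I.d
    · rw [dif_pos ⟨i.2, ht⟩] at hx
      rw [dif_pos ⟨j.2, ht⟩] at hy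
      exact h ⟨m * k + s, ht⟩ ⟨hx, hy⟩
    · rw [dif_neg (fun h' => ht h'.2)] at hx
      exact Bool.false_ne_true hx
  · rintro ⟨i, hi, j, hj, h⟩
    refine ⟨⟨i, hi⟩, ⟨j, hj⟩, fun t ⟨hx, hy⟩ => ?_⟩
    have htd : (t : ℕ) < I.d := t.2
    have hm : (t : ℕ) / k < B := by
      rw [Nat.div_lt_iff_lt_mul hk]; exact lt_of_lt_of_le htd hB
    have ht : (t : ℕ) / k * k + (t : ℕ) % k = t := Nat.div_add_mod' t k
    refine h (t / k) hm ⟨(t : ℕ) % k, Nat.mod_lt _ hk⟩ ⟨?_, ?_⟩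
    · simp only [blk, rowA, ht]
      rw [dif_pos ⟨hi, htd⟩]; exact hx
    · simp only [blk, rowB, ht]
      rw [dif_pos ⟨hj, htd⟩]; exact hy

namespace PosRep

/-- **The decision criterion of the algorithm**: for the rows of an OV instance read in `B ≥ d/k`
blocks of `k ≥ 1` bits, `S ≠ 0` iff the instance has an orthogonal pair (Williams, ECCC TR24-142,
Thm. 10 for the representation of Thm. 8). [cite: WilliamsFOCS2024, Thm. 8, Thm. 10] -/
theorem S_ne_zero_iff_hasOrthogonalPair (I : OVInstance) {B : ℕ} (hk : 0 < k) (hB : I.d ≤ B * k) :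
    R.S I.n B (rowA I) (rowB I) ≠ 0 ↔ I.HasOrthogonalPair := by
  rw [S_ne_zero_iff, hasOrthogonalPair_iff_blocks I hk hB]

/-! ### Key bounds -/

/-- Row keys are base-`2^lam` numbers with `B` digits. [folklore] -/
theorem keyU_range (B : ℕ) (X : ℕ → ℕ → Bool) (Q i : ℕ) :
    0 ≤ R.keyU B X Q i ∧ R.keyU B X Q i < 2 ^ (lam * B) :=
  sum_digits_lt (fun m => (R.test (digit ρ Q m)).u (blk k X i m)) fun _ _ => R.u_range _ _

/-- Column keys are base-`2^lam` numbers with `B` digits. [folklore] -/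
theorem keyV_range (B : ℕ) (Y : ℕ → ℕ → Bool) (Q j : ℕ) :
    0 ≤ R.keyV B Y Q j ∧ R.keyV B Y Q j < 2 ^ (lam * B) :=
  sum_digits_lt (fun m => (R.test (digit ρ Q m)).v (blk k Y j m)) fun _ _ => R.v_range _ _

/-- The count is at most `n²`. [folklore] -/
theorem tcount_le (n B : ℕ) (X Y : ℕ → ℕ → Bool) (Q : ℕ) : R.tcount n B X Y Q ≤ n * n := by
  unfold tcount
  calc ∑ j ∈ range n, ((range n).filter fun i => R.keyU B X Q i = R.keyV B Y Q j).card
      ≤ ∑ _j ∈ range n, n := Finset.sum_le_sum fun j _ =>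
          (Finset.card_filter_le _ _).trans (Finset.card_range n).le
    _ = n * n := by rw [Finset.sum_const, Finset.card_range, smul_eq_mul]

/-! ### Machine forms: weights and constants indexed by bit positions -/

/-- Row weights extended to all bit indices (`0` past `k`). [folklore] -/
def _root_.Literature.Computability.FineGrained.EThr2.AffTest.wuN (T : AffTest k) (s : ℕ) : ℤ :=
  if h : s < k then T.wu ⟨s, h⟩ else 0

/-- Column weights extended to all bit indices. [folklore] -/
def _root_.Literature.Computability.FineGrained.EThr2.AffTest.wvN (T : AffTest k) (s : ℕ) : ℤ :=
  if h : s < k then T.wv ⟨s, h⟩ else 0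

/-- The weight of bit `t` of a row in the row key of the `Q`-th term:
`wu_{Q_{t/k}, t mod k} · 2^{lam (t/k)}`. [cite: WilliamsFOCS2024, Thm. 8 (proof)] -/
def WtU (Q t : ℕ) : ℤ := (R.test (digit ρ Q (t / k))).wuN (t % k) * 2 ^ (lam * (t / k))

/-- The weight of bit `t` of a row in the column key of the `Q`-th term. [cite: WilliamsFOCS2024, Thm. 8 (proof)] -/
def WtV (Q t : ℕ) : ℤ := (R.test (digit ρ Q (t / k))).wvN (t % k) * 2 ^ (lam * (t / k))

/-- The constant of the row key contributed at bit position `t` (only at block starts). [folklore] -/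
def cuT (Q t : ℕ) : ℤ :=
  if t % k = 0 then (R.test (digit ρ Q (t / k))).cu * 2 ^ (lam * (t / k)) else 0

/-- The constant of the column key contributed at bit position `t` (only at block starts). [folklore] -/
def cvT (Q t : ℕ) : ℤ :=
  if t % k = 0 then (R.test (digit ρ Q (t / k))).cv * 2 ^ (lam * (t / k)) else 0

/-- The coefficient factor contributed at bit position `t` (only at block starts). [folklore] -/
def alT (Q t : ℕ) : ℤ := if t % k = 0 then R.α (digit ρ Q (t / k)) else 1

/-- The constant part `Σ_{m<B} cu_{Q_m} 2^{lam m}` of the row keys. [folklore] -/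
def cuQ (B Q : ℕ) : ℤ := ∑ m ∈ range B, (R.test (digit ρ Q m)).cu * 2 ^ (lam * m)

/-- The constant part `Σ_{m<B} cv_{Q_m} 2^{lam m}` of the column keys. [folklore] -/
def cvQ (B Q : ℕ) : ℤ := ∑ m ∈ range B, (R.test (digit ρ Q m)).cv * 2 ^ (lam * m)

section machine

variable (hk : 0 < k)
include hk

/-- Index arithmetic inside block `m`. [folklore] -/
private theorem div_mod_block (m s : ℕ) (hs : s < k) : (m * k + s) / k = m ∧ (m * k + s) % k = s :=
  ⟨by rw [Nat.add_comm, Nat.add_mul_div_right _ _ hk, Nat.div_eq_of_lt hs, Nat.zero_add],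
   by rw [Nat.add_comm, Nat.add_mul_mod_self_right, Nat.mod_eq_of_lt hs]⟩

/-- The coefficient as a product over bit positions. [folklore] -/
theorem coef_eq_prod_alT (B Q : ℕ) : R.coef B Q = ∏ t ∈ range (B * k), R.alT Q t := by
  rw [prod_range_mul_eq, coef]
  refine Finset.prod_congr rfl (fun m _ => ?_)
  rw [Finset.prod_eq_single_of_mem 0 (Finset.mem_range.2 hk) (fun s hs hs0 => ?_)]
  · obtain ⟨h1, h2⟩ := div_mod_block hk m 0 hk
    rw [Nat.add_zero] at h1 h2
    simp only [alT, Nat.add_zero, h1, h2, if_true]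
  · obtain ⟨-, h2⟩ := div_mod_block hk m s (Finset.mem_range.1 hs)
    simp only [alT, h2, if_neg hs0]

/-- A sum over bit positions that only charges block starts. [folklore] -/
private theorem sum_blockStart (B : ℕ) (c : ℕ → ℤ) :
    ∑ t ∈ range (B * k), (if t % k = 0 then c (t / k) else 0) = ∑ m ∈ range B, c m := by
  rw [sum_range_mul_eq]
  refine Finset.sum_congr rfl (fun m _ => ?_)
  rw [Finset.sum_eq_single_of_mem 0 (Finset.mem_range.2 hk) (fun s hs hs0 => ?_)]
  · obtain ⟨h1, h2⟩ := div_mod_block hk m 0 hk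
    rw [Nat.add_zero] at h1 h2
    simp only [Nat.add_zero, h1, h2, if_true]
  · obtain ⟨-, h2⟩ := div_mod_block hk m s (Finset.mem_range.1 hs)
    simp only [h2, if_neg hs0]

/-- The row constants as a sum over bit positions. [folklore] -/
theorem cuQ_eq_sum (B Q : ℕ) : R.cuQ B Q = ∑ t ∈ range (B * k), R.cuT Q t := by
  rw [cuQ, ← sum_blockStart hk B (fun m => (R.test (digit ρ Q m)).cu * 2 ^ (lam * m))]
  rfl

/-- The column constants as a sum over bit positions. [folklore] -/
theorem cvQ_eq_sum (B Q : ℕ) : R.cvQ B Q = ∑ t ∈ range (B * k), R.cvT Q t := by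
  rw [cvQ, ← sum_blockStart hk B (fun m => (R.test (digit ρ Q m)).cv * 2 ^ (lam * m))]
  rfl

/-- **Row keys are linear in the bits**: `keyU Q i = cuQ Q + Σ_{t < Bk} WtU Q t · X_i[t]`. [cite: WilliamsFOCS2024, Thm. 8 (proof)] -/
theorem keyU_eq_sum_Wt (B : ℕ) (X : ℕ → ℕ → Bool) (Q i : ℕ) :
    R.keyU B X Q i = R.cuQ B Q + ∑ t ∈ range (B * k), R.WtU Q t * (if X i t then 1 else 0) := by
  rw [sum_range_mul_eq, cuQ, keyU, ← Finset.sum_add_distrib]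
  refine Finset.sum_congr rfl (fun m _ => ?_)
  rw [AffTest.u, add_mul, Finset.sum_mul, Finset.sum_range (fun s => R.WtU Q (m * k + s) * _)]
  congr 1
  refine Finset.sum_congr rfl (fun s _ => ?_)
  obtain ⟨h1, h2⟩ := div_mod_block hk m s s.2
  simp only [WtU, h1, h2, AffTest.wuN, dif_pos s.2, blk, Fin.eta]
  split_ifs <;> ring

/-- **Column keys are linear in the bits**: `keyV Q j = cvQ Q + Σ_{t < Bk} WtV Q t · Y_j[t]`. [cite: WilliamsFOCS2024, Thm. 8 (proof)] -/
theorem keyV_eq_sum_Wt (B : ℕ) (Y : ℕ → ℕ → Bool) (Q j : ℕ) :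
    R.keyV B Y Q j = R.cvQ B Q + ∑ t ∈ range (B * k), R.WtV Q t * (if Y j t then 1 else 0) := by
  rw [sum_range_mul_eq, cvQ, keyV, ← Finset.sum_add_distrib]
  refine Finset.sum_congr rfl (fun m _ => ?_)
  rw [AffTest.v, add_mul, Finset.sum_mul, Finset.sum_range (fun s => R.WtV Q (m * k + s) * _)]
  congr 1
  refine Finset.sum_congr rfl (fun s _ => ?_)
  obtain ⟨h1, h2⟩ := div_mod_block hk m s s.2
  simp only [WtV, h1, h2, AffTest.wvN, dif_pos s.2, blk, Fin.eta]
  split_ifs <;> ring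

end machine

end PosRep

end EThr2

end Literature.Computability.FineGrained
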